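import Literature.Probability.RandomPlanarGeometry.SAWLoopErasureMemoryTwoSeries
import Literature.Probability.RandomPlanarGeometry.SAWLoopErasureMemoryTwoPenultimate
import HarnessLib

/-!
# Hara–Slade–Sokal loop erasure with memory `τ = 2` and a `k`-SITE TABOO CHAIN, series level:
`μ(ℤ^d) ≥ (2d−1)/Π̃₂(k; 1/(2d−1))` for every `k ≥ 0` (`d ≥ 3`)

Topic `Literature/Probability/RandomPlanarGeometry`; a child of the tree's `SAWLoopErasureMemoryTwoSeries.lean` (the
case `k = 1`: `sum_card_nbwAvoid_mul_pow_le_step` — the series form of the fibre inequality, for ANY obstacle `A` — is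
used BY NAME, as are `nbwAvoid`, `closedNbwPen`, `nbwLoopsAll`, `card_closedNbwPen_mono`,
`card_closedNbwPen_le_nbwLoopsAll`, `nbwAvoid_eq_empty_of_mem`, `card_nbwAvoid_empty`, `div_le_connectiveConstant_of`,
`one_le_card_nbwWords_mul_pow`, `sum_nbwLoopsAll_mul_pow_le`, `nbwLoopsAll_zero` of `SAWLoopErasureMemoryTwo.lean`,
`sawAvoid`, `shiftSet`, `mem_shiftSet`, `sum_card_sawAvoid_shift_le`, `card_sawAvoid_zero`, `card_sawAvoid_empty`,
`stepVec_ne_zero` of `SAWLoopErasureKesten.lean`, `pos_cons_succ` of `LaceExpansionSAWIdentity.lean` and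
`pos_snoc_of_le` of `SAWLoopErasureMemoryTwoPenultimate.lean`).

The tree's `hss_memoryTwo_series_div_le_connectiveConstant` is (2.39) with `τ = 2` and `k = 1`: the loops attached to
the backbone from the second pivot on avoid the ONE preceding backbone site (`A = {e_t}`).  The source allows any
`k ≥ 0`: "`Π̃_τ(k;β) = max_{A,e} C̃^{A;e}_τ(0,0;β)` (2.36) where the maximum ranges over all `k`-element sets `A` which
are the range of a `(k−1)`-step self-avoiding walk starting at a nearest neighbour of the origin, and over all nearest
neighbours `e` of the origin satisfying `e ∉ A`", and Table 2 lists the rows `(2̃,k)`, `k = 0, …, 4`.  This module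
runs the series-level decoration induction with the loops avoiding the `k` PRECEDING backbone sites: seen from a
pivot reached after at least `k` backbone steps, these sites are the TABOO CHAIN `chainSet τ = {τ(1), …, τ(k)}` of the
reversed backbone piece `τ` (a `k`-step self-avoiding word from the pivot), and the next backbone step `e_s` avoids
it.  The first `k` pivots carry shorter chains; there (footnote 2 of the source: "we are overcounting by neglecting the
avoidance … for the first `k` sites of the backbone") the loops are bounded by ALL closed NBW loops, which costs a
finite constant `chainStartConst B₀ W k` and does not affect the growth rate.

## What the source prints (HSS93 = Hara–Slade–Sokal, J. Stat. Phys. 72 (1993) 479–517 = arXiv:hep-lat/9302003)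

PDF p. 12 (printed p. 10), §2.4 "Inequalities (second version)": "The foregoing inequalities are based on
constraining the attached loops to avoid the preceding `k` sites of the backbone. For any memory `τ ≥ 2`, we can
improve these results by using (2.18)/(2.20), i.e. by taking into account the further constraint that the next-to-last
site of the loop avoid the next site of the backbone. … We introduce `Π̃_τ(k;β) = max_{A,e} C̃^{A;e}_τ(0,0;β)` (2.36)
where the maximum ranges over all `k`-element sets `A` which are the range of a `(k−1)`-step self-avoiding walk
starting at a nearest neighbour of the origin, and over all nearest neighbours `e` of the origin satisfying `e ∉ A`.
The analogue of (2.24) becomes `C_τ(x,y;β) ≤ … Π̃_τ(0;β) ⋯ Π̃_τ(k−1;β) Π̃_τ(k;β)^{|ω|−k} …` (2.37)", with footnote 2: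
"Here we are overcounting by neglecting the avoidance of the next backbone site, for the first `k` sites of the
backbone, to allow for a unified treatment of `j ≤ k−1` and `j ≥ k`."  PDF p. 13 (printed p. 11): "Arguing as before,
we have `μ ≥ μ_τ / Π̃_τ(k; μ_τ^{−1})` for `τ = 2, k ≥ 0, d > 0` (2.39)", `μ₂ = 2d − 1` (§2.3).

## What is typed (standard axioms; no `sorry`; every generating function as PARTIAL SUMS)

* `chainSet τ` (the sites `τ(1), …, τ(k)` of a `k`-step word), `HasChain k A` (`A ⊇ chainSet τ` for some `k`-step
  word `τ` injective on the times `0, …, k`), and the bookkeeping `hasChain_zero`, `hasChain_shiftSet` (one backbone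
  step `e_s ∉ A`: the shifted obstacle `(A ∪ {0}) − e_s` contains the chain of `(−s)·τ`, one site longer),
  `hasChain_of_succ` (drop the last site);
* `sum_card_nbwAvoid_mul_pow_le_of_hasChain`: the SATURATED regime — if `Σ_{j≤K} b_j(0) β^j ≤ B₀` and
  `Σ_{j≤K} #closedNbwPen (chainSet τ) s j β^j ≤ W` for every `k`-step `τ` injective on `0..k` and every `e_s ∉ chainSet τ`
  (all `K`), then for every obstacle `A ∌ 0` with `HasChain k A`,
  `Σ_{n≤K} #nbwAvoid A n βⁿ ≤ B₀ Σ_{m≤K} #sawAvoid A m β^m W^m` (strong induction on `K`; the loop series at the pivot is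
  at most `W` by monotonicity in the obstacle, `chainSet τ ⊆ A`);
* `chainStartConst B₀ W i` (`= B₀` for `i = 0`, `B₀ (1 + chainStartConst i · W⁻¹)` for `i + 1`) and
  `sum_card_nbwAvoid_mul_pow_le_startup`: the START-UP regime — with only a `j`-chain in `A`, `j + i = k`, the same sum
  is at most `chainStartConst B₀ W i · Σ_{m≤K} #sawAvoid A m β^m W^m` (induction on `i`, the loop at the pivot bounded by `B₀`);
* `sum_card_nbwWords_mul_pow_le_chain`: the whole word, `Σ_{n≤K} b_n βⁿ ≤ chainStartConst B₀ W k · Σ_{m≤K} c_m β^m W^m`;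
* **`hss_memoryTwo_chain_div_le_connectiveConstant (hd : 3 ≤ d) (k : ℕ)`: if `W > 0` bounds the partial sums
  `Σ_{j≤K} #closedNbwPen (chainSet τ) s j (2d−1)^{−j}` for every `k`-step word `τ` injective on the times `0, …, k`
  and every direction `s` with `e_s ∉ chainSet τ`, then `(2d−1)/W ≤ μ(ℤ^d)`** — (2.39) with `τ = 2` and `Π̃₂(k;1/(2d−1))`
  replaced by any bound on the partial sums of the series whose maximum over the geometry `(A, e) = (chainSet τ, e_s)`
  it is (never weaker: the maximum of the series is at most any common bound);
* `chainSet_two`, **`hss_memoryTwo_twoChain_div_le_connectiveConstant`**: the case `k = 2` spelled out — the taboo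
  sets are `A = {e_t, e_t + e_{t'}}` with `t' ≠ −t`, the next step any `s ≠ t` (row `(2̃,2)` of Table 2, before the
  evaluation of the series).

NOT CLAIMED: the evaluation of the series `C̃^{A;e}₂(0,0;β)` by the linear systems of §3 and the decimal rows `(2̃,k)`,
`k ≥ 2`, of Table 2; the sharper start-up factors `Π̃(0) ⋯ Π̃(k−1)` of (2.37)–(2.38) (irrelevant to (2.39)); memories
`τ ≥ 4`; the optimised bounds `(2̃;k)opt` of §2.5.  Label (proposed): PORT of (2.36)+(2.39) [`τ = 2`, every `k ≥ 0`,
`Π̃` as a hypothesis-bounded partial sum, maximum over the geometry at SERIES level]; a child of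
`SAWLoopErasureMemoryTwoSeries` (tree).
-/

noncomputable section

namespace Literature.Probability.RandomPlanarGeometry.SAW.Zd.LoopErasure

open Finset Filter Topology
open scoped BigOperators
open Literature.Probability.LatticeModels Literature.Probability.LatticeModels.SRW
open Literature.Barriers.CriticalPhenomena Literature.Barriers.CriticalPhenomena.SAWLace
open Literature.Probability.FitznerVanDerHofstad2017
open Literature.Probability.Percolation (IsNBW nbwWords nbwWordsTo mem_nbwWords srev srev_srev)

variable {d : ℕ}

/-! ### Taboo chains -/

/-- The TABOO CHAIN of a `k`-step word `τ` from the pivot: the sites `τ(1), …, τ(k)` — for `τ` self-avoiding, a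
`k`-element set which is the range of the `(k−1)`-step self-avoiding walk `i ↦ τ(i+1)` starting at the neighbour
`τ(1)` of the origin.
[cite: HaraSladeSokal1993, §2.4 eq. (2.36) p. 10 (the k-element sets A: "the range of a (k−1)-step self-avoiding walk starting at a nearest neighbour of the origin")] -/
def chainSet {k : ℕ} (τ : StepSeq d k) : Finset (Site d) :=
  (Finset.range k).image fun i => pos τ (i + 1)

/-- Membership in the taboo chain. [cite: HaraSladeSokal1993, §2.4 eq. (2.36) p. 10 (lane plumbing)] -/
theorem mem_chainSet {k : ℕ} {τ : StepSeq d k} {y : Site d} :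
    y ∈ chainSet τ ↔ ∃ i : ℕ, i < k ∧ pos τ (i + 1) = y := by
  unfold chainSet
  rw [Finset.mem_image]
  constructor
  · rintro ⟨i, hi, rfl⟩
    exact ⟨i, Finset.mem_range.1 hi, rfl⟩
  · rintro ⟨i, hi, rfl⟩
    exact ⟨i, Finset.mem_range.2 hi, rfl⟩

/-- The sites `τ(t)`, `1 ≤ t ≤ k`, belong to the taboo chain. [cite: HaraSladeSokal1993, §2.4 eq. (2.36) p. 10 (lane plumbing)] -/
theorem pos_mem_chainSet {k : ℕ} (τ : StepSeq d k) {t : ℕ} (h1 : 1 ≤ t) (ht : t ≤ k) :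
    pos τ t ∈ chainSet τ := by
  rw [mem_chainSet]
  exact ⟨t - 1, by omega, by rw [Nat.sub_add_cancel h1]⟩

/-- **The obstacle `A` contains a `k`-chain**: `chainSet τ ⊆ A` for some `k`-step word `τ` whose positions at the times
`0, …, k` are distinct (so the chain misses the pivot).  This is the shape of the obstacle seen from every pivot of the
backbone reached after at least `k` steps: the `k` preceding backbone sites.
[cite: HaraSladeSokal1993, §2.4 eq. (2.36)–(2.37) p. 10 ("constraining the attached loops to avoid the preceding k sites of the backbone")] -/
def HasChain (k : ℕ) (A : Finset (Site d)) : Prop :=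
  ∃ τ : StepSeq d k, Set.InjOn (pos τ) (Set.Icc 0 k) ∧ chainSet τ ⊆ A

/-- Every obstacle contains the empty chain. [cite: HaraSladeSokal1993, §2.4 eq. (2.36) p. 10 (k = 0; lane plumbing)] -/
theorem hasChain_zero (A : Finset (Site d)) : HasChain 0 A := by
  refine ⟨fun i => Fin.elim0 i, fun a ha b hb _ => ?_, fun y hy => ?_⟩
  · rw [Set.mem_Icc] at ha hb
    omega
  · rw [mem_chainSet] at hy
    obtain ⟨i, hi, _⟩ := hy
    omega

/-- **One backbone step.**  If `e_s ∉ A` and `A` contains the `k`-chain of `τ`, then the shifted obstacle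
`(A ∪ {0}) − e_s` (the obstacle seen from the next pivot `e_s`) contains the `(k+1)`-chain of `(−s)·τ`: the old pivot
followed by the old chain (distinct positions: `e_s ≠ 0` and `e_s` is not on the old chain).
[cite: HaraSladeSokal1993, §2.4 eq. (2.36)–(2.37) p. 10 (the preceding backbone sites, one pivot later; lane plumbing)] -/
theorem hasChain_shiftSet {k : ℕ} {A : Finset (Site d)} (hA : HasChain k A) {s : Dir d} (hs : stepVec s ∉ A) :
    HasChain (k + 1) (shiftSet A s) := by
  obtain ⟨τ, hinj, hsub⟩ := hA
  have hpos : ∀ t : ℕ, pos (Fin.cons s.neg τ : StepSeq d (k + 1)) (t + 1) = pos τ t - stepVec s := fun t => by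
    rw [pos_cons_succ, stepVec_neg, neg_add_eq_sub]
  have hne : ∀ t : ℕ, t ≤ k → pos τ t ≠ stepVec s := by
    intro t ht h
    rcases Nat.eq_zero_or_pos t with rfl | ht0
    · exact stepVec_ne_zero s (by rw [← h, pos_zero])
    · exact hs (by rw [← h]; exact hsub (pos_mem_chainSet τ ht0 ht))
  refine ⟨(Fin.cons s.neg τ : StepSeq d (k + 1)), fun a ha b hb hab => ?_, fun y hy => ?_⟩
  · rw [Set.mem_Icc] at ha hb
    cases a with
    | zero =>
      cases b with
      | zero => rfl
      | succ b' =>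
        exfalso
        rw [pos_zero, hpos] at hab
        exact hne b' (by omega) (sub_eq_zero.1 hab.symm)
    | succ a' =>
      cases b with
      | zero =>
        exfalso
        rw [pos_zero, hpos] at hab
        exact hne a' (by omega) (sub_eq_zero.1 hab)
      | succ b' =>
        rw [hpos, hpos, sub_left_inj] at hab
        rw [hinj (Set.mem_Icc.2 ⟨Nat.zero_le _, by omega⟩) (Set.mem_Icc.2 ⟨Nat.zero_le _, by omega⟩) hab]
  · rw [mem_chainSet] at hy
    obtain ⟨i, hi, rfl⟩ := hy
    rw [hpos, mem_shiftSet, sub_add_cancel]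
    rcases Nat.eq_zero_or_pos i with rfl | hi0
    · rw [pos_zero]
      exact Finset.mem_insert_self _ _
    · exact Finset.mem_insert_of_mem (hsub (pos_mem_chainSet τ hi0 (by omega)))

/-- Dropping the far end of a chain: a `(k+1)`-chain contains a `k`-chain. [cite: HaraSladeSokal1993, §2.4 eq. (2.36) p. 10 (lane plumbing)] -/
theorem hasChain_of_succ {k : ℕ} {A : Finset (Site d)} (hA : HasChain (k + 1) A) : HasChain k A := by
  obtain ⟨τ, hinj, hsub⟩ := hA
  have hpos : ∀ t : ℕ, t ≤ k → pos (Fin.init τ : StepSeq d k) t = pos τ t := fun t ht => by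
    have h := pos_snoc_of_le (Fin.init τ : StepSeq d k) (τ (Fin.last k)) ht
    rw [Fin.snoc_init_self] at h
    exact h.symm
  refine ⟨(Fin.init τ : StepSeq d k), fun a ha b hb hab => ?_, fun y hy => ?_⟩
  · rw [Set.mem_Icc] at ha hb
    rw [hpos a ha.2, hpos b hb.2] at hab
    exact hinj (Set.mem_Icc.2 ⟨ha.1, ha.2.trans (Nat.le_succ k)⟩)
      (Set.mem_Icc.2 ⟨hb.1, hb.2.trans (Nat.le_succ k)⟩) hab
  · rw [mem_chainSet] at hy
    obtain ⟨i, hi, rfl⟩ := hy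
    rw [hpos (i + 1) hi]
    exact hsub (pos_mem_chainSet τ (Nat.succ_pos i) (by omega))

/-! ### The saturated regime: a full `k`-chain behind the pivot -/

/-- **The memory-2 loop erasure with a `k`-site taboo chain, saturated regime, at series level.**  Let `β ≥ 0`, `W ≥ 0`,
`Σ_{j≤K} b_j(0) β^j ≤ B₀` (all `K`), and suppose that for every `k`-step word `τ` with distinct positions at the times
`0, …, k` and every direction `s` with `e_s ∉ chainSet τ` the penalised loop series is bounded:
`Σ_{j≤K} #closedNbwPen (chainSet τ) s j β^j ≤ W` (all `K`).  Then for every obstacle `A ∌ 0` containing a `k`-chain,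
`Σ_{n≤K} #nbwAvoid A n βⁿ ≤ B₀ · Σ_{m≤K} #sawAvoid A m β^m W^m`: the loop series at the pivot is at most
`C̃^{chainSet τ; e_s}₂ ≤ W` by monotonicity in the obstacle, and the obstacle seen from the next pivot again contains a
`k`-chain (`hasChain_shiftSet`, `hasChain_of_succ`).
[cite: HaraSladeSokal1993, §2.4 eq. (2.36)–(2.38) p. 10 (τ = 2, general k, pivots j ≥ k; Π̃ = max over the geometry of the SERIES)] -/
theorem sum_card_nbwAvoid_mul_pow_le_of_hasChain {β W B₀ : ℝ} (hβ : 0 ≤ β) (hW0 : 0 ≤ W)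
    (hB₀ : ∀ K : ℕ, ∑ j ∈ range (K + 1), (nbwLoopsAll d j : ℝ) * β ^ j ≤ B₀) (k : ℕ)
    (hW : ∀ (τ : StepSeq d k) (s : Dir d), Set.InjOn (pos τ) (Set.Icc 0 k) → stepVec s ∉ chainSet τ →
      ∀ K : ℕ, ∑ j ∈ range (K + 1), ((closedNbwPen (chainSet τ) s j).card : ℝ) * β ^ j ≤ W)
    (K : ℕ) : ∀ A : Finset (Site d), (0 : Site d) ∉ A → HasChain k A →
    ∑ n ∈ range (K + 1), ((nbwAvoid A n).card : ℝ) * β ^ n ≤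
      B₀ * ∑ m ∈ range (K + 1), ((sawAvoid A m).card : ℝ) * β ^ m * W ^ m := by
  induction K using Nat.strong_induction_on with
  | _ K ih =>
  intro A h0 hA
  obtain ⟨τ, hinj, hsub⟩ := hA
  have hB₀0 : 0 ≤ B₀ :=
    (Finset.sum_nonneg fun j _ => mul_nonneg (Nat.cast_nonneg _) (pow_nonneg hβ _)).trans (hB₀ 0)
  -- the loop series at this pivot
  have hloop : ∀ s : Dir d, stepVec s ∉ A →
      ∑ j ∈ range K, ((closedNbwPen A s j).card : ℝ) * β ^ j ≤ W := by
    intro s hs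
    have hsτ : stepVec s ∉ chainSet τ := fun h => hs (hsub h)
    have hmono : ∑ j ∈ range K, ((closedNbwPen A s j).card : ℝ) * β ^ j ≤
        ∑ j ∈ range K, ((closedNbwPen (chainSet τ) s j).card : ℝ) * β ^ j :=
      Finset.sum_le_sum fun j _ => mul_le_mul_of_nonneg_right
        (by exact_mod_cast card_closedNbwPen_mono hsub s j) (pow_nonneg hβ _)
    refine hmono.trans ?_
    cases K with
    | zero => simpa using hW0
    | succ K' => exact hW τ s hinj hsτ K'
  -- the tail series (induction hypothesis)
  have htail : ∀ s : Dir d, (0 : Site d) ∉ shiftSet A s →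
      ∑ j ∈ range K, ((nbwAvoid (shiftSet A s) j).card : ℝ) * β ^ j ≤
        B₀ * ∑ m ∈ range K, ((sawAvoid (shiftSet A s) m).card : ℝ) * β ^ m * W ^ m := by
    intro s hs
    cases K with
    | zero => simp
    | succ K' =>
      have hsA : stepVec s ∉ A := by
        intro hmem
        apply hs
        rw [mem_shiftSet, zero_add]
        exact Finset.mem_insert_of_mem hmem
      exact ih K' (by omega) (shiftSet A s) hs (hasChain_of_succ (hasChain_shiftSet ⟨τ, hinj, hsub⟩ hsA))
  -- per next step `s`
  have hterm : ∀ s : Dir d,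
      (∑ j ∈ range K, ((closedNbwPen A s j).card : ℝ) * β ^ j) *
          ∑ j ∈ range K, ((nbwAvoid (shiftSet A s) j).card : ℝ) * β ^ j ≤
        W * (B₀ * ∑ m ∈ range K, ((sawAvoid (shiftSet A s) m).card : ℝ) * β ^ m * W ^ m) := by
    intro s
    have hR0 : 0 ≤ W * (B₀ * ∑ m ∈ range K, ((sawAvoid (shiftSet A s) m).card : ℝ) * β ^ m * W ^ m) :=
      mul_nonneg hW0 (mul_nonneg hB₀0 (Finset.sum_nonneg fun m _ =>
        mul_nonneg (mul_nonneg (Nat.cast_nonneg _) (pow_nonneg hβ _)) (pow_nonneg hW0 _)))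
    by_cases h0s : (0 : Site d) ∈ shiftSet A s
    · have hz : ∑ j ∈ range K, ((nbwAvoid (shiftSet A s) j).card : ℝ) * β ^ j = 0 := by
        refine Finset.sum_eq_zero fun j _ => ?_
        rw [nbwAvoid_eq_empty_of_mem h0s, Finset.card_empty, Nat.cast_zero, zero_mul]
      rw [hz, mul_zero]
      exact hR0
    · have hs : stepVec s ∉ A := by
        intro hmem
        apply h0s
        rw [mem_shiftSet, zero_add]
        exact Finset.mem_insert_of_mem hmem
      exact mul_le_mul (hloop s hs) (htail s h0s)
        (Finset.sum_nonneg fun j _ => mul_nonneg (Nat.cast_nonneg _) (pow_nonneg hβ _)) hW0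
  -- summing over `s` and shifting the backbone
  have hsum : ∑ s : Dir d, (∑ j ∈ range K, ((closedNbwPen A s j).card : ℝ) * β ^ j) *
        ∑ j ∈ range K, ((nbwAvoid (shiftSet A s) j).card : ℝ) * β ^ j ≤
      W * (B₀ * ∑ m ∈ range K, ((sawAvoid A (m + 1)).card : ℝ) * β ^ m * W ^ m) := by
    refine (Finset.sum_le_sum fun s _ => hterm s).trans ?_
    rw [← Finset.mul_sum, ← Finset.mul_sum]
    refine mul_le_mul_of_nonneg_left (mul_le_mul_of_nonneg_left ?_ hB₀0) hW0
    rw [Finset.sum_comm]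
    refine Finset.sum_le_sum fun m _ => ?_
    rw [← Finset.sum_mul, ← Finset.sum_mul]
    refine mul_le_mul_of_nonneg_right (mul_le_mul_of_nonneg_right ?_ (pow_nonneg hβ _)) (pow_nonneg hW0 _)
    exact_mod_cast sum_card_sawAvoid_shift_le h0 m
  -- assembling
  have hfirst : ∑ n ∈ range (K + 1), (nbwLoopsAll d n : ℝ) * β ^ n ≤ B₀ := hB₀ K
  have hsplit : B₀ * ∑ m ∈ range (K + 1), ((sawAvoid A m).card : ℝ) * β ^ m * W ^ m =
      B₀ + β * (W * (B₀ * ∑ m ∈ range K, ((sawAvoid A (m + 1)).card : ℝ) * β ^ m * W ^ m)) := by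
    rw [Finset.sum_range_succ' _ K, card_sawAvoid_zero h0, Nat.cast_one, pow_zero, pow_zero, mul_one, mul_one,
      mul_add, mul_one, add_comm]
    simp only [Finset.mul_sum]
    congr 1
    refine Finset.sum_congr rfl fun m _ => ?_
    rw [pow_succ, pow_succ]
    ring
  rw [hsplit]
  refine (sum_card_nbwAvoid_mul_pow_le_step hβ A K).trans ?_
  exact add_le_add hfirst (mul_le_mul_of_nonneg_left hsum hβ)

/-! ### The start-up regime: the first `k` pivots -/

/-- **The start-up constants**: `chainStartConst B₀ W 0 = B₀` (the saturated regime) and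
`chainStartConst B₀ W (i+1) = B₀ (1 + chainStartConst B₀ W i · W⁻¹)` — at a pivot with fewer than `k` backbone sites behind it the
loop series is bounded by the free one, `Σ_j b_j(0) β^j ≤ B₀`, and any finite bound there is harmless for the growth rate.
[cite: HaraSladeSokal1993, §2.4 eq. (2.37)–(2.38) p. 10 and footnote 2 (the first k backbone sites are treated separately)] -/
def chainStartConst (B₀ W : ℝ) : ℕ → ℝ
  | 0 => B₀
  | i + 1 => B₀ * (1 + chainStartConst B₀ W i * W⁻¹)

/-- The defining recursion of `chainStartConst`, successor case. [cite: HaraSladeSokal1993, §2.4 eq. (2.37)–(2.38) p. 10 (lane plumbing)] -/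
theorem chainStartConst_succ (B₀ W : ℝ) (i : ℕ) :
    chainStartConst B₀ W (i + 1) = B₀ * (1 + chainStartConst B₀ W i * W⁻¹) := rfl

/-- `chainStartConst B₀ W i ≥ 0` for `B₀, W ≥ 0`. [cite: HaraSladeSokal1993, §2.4 eq. (2.37)–(2.38) p. 10 (lane plumbing)] -/
theorem chainStartConst_nonneg {B₀ W : ℝ} (hB₀ : 0 ≤ B₀) (hW : 0 ≤ W) :
    ∀ i : ℕ, 0 ≤ chainStartConst B₀ W i
  | 0 => hB₀
  | i + 1 => mul_nonneg hB₀ (add_nonneg zero_le_one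
      (mul_nonneg (chainStartConst_nonneg hB₀ hW i) (inv_nonneg.2 hW)))

/-- **The start-up regime, at series level.**  Under the hypotheses of `sum_card_nbwAvoid_mul_pow_le_of_hasChain`
(with `W > 0`), for every obstacle `A ∌ 0` containing only a `j`-chain, `j + i = k`,
`Σ_{n≤K} #nbwAvoid A n βⁿ ≤ chainStartConst B₀ W i · Σ_{m≤K} #sawAvoid A m β^m W^m` (induction on `i`: the loop series at the
pivot is at most `B₀`, the tails see a `(j+1)`-chain, and `Σ_{m≤K} #sawAvoid A m β^m W^m ≥ 1`).
[cite: HaraSladeSokal1993, §2.4 eq. (2.37)–(2.38) p. 10 and footnote 2 ("overcounting by neglecting the avoidance … for the first k sites of the backbone")] -/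
theorem sum_card_nbwAvoid_mul_pow_le_startup {β W B₀ : ℝ} (hβ : 0 ≤ β) (hW0 : 0 < W)
    (hB₀ : ∀ K : ℕ, ∑ j ∈ range (K + 1), (nbwLoopsAll d j : ℝ) * β ^ j ≤ B₀) (k : ℕ)
    (hW : ∀ (τ : StepSeq d k) (s : Dir d), Set.InjOn (pos τ) (Set.Icc 0 k) → stepVec s ∉ chainSet τ →
      ∀ K : ℕ, ∑ j ∈ range (K + 1), ((closedNbwPen (chainSet τ) s j).card : ℝ) * β ^ j ≤ W)
    (i : ℕ) : ∀ j : ℕ, j + i = k → ∀ (K : ℕ) (A : Finset (Site d)), (0 : Site d) ∉ A → HasChain j A →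
    ∑ n ∈ range (K + 1), ((nbwAvoid A n).card : ℝ) * β ^ n ≤
      chainStartConst B₀ W i * ∑ m ∈ range (K + 1), ((sawAvoid A m).card : ℝ) * β ^ m * W ^ m := by
  induction i with
  | zero =>
    intro j hj K A h0 hA
    rw [add_zero] at hj
    subst hj
    exact sum_card_nbwAvoid_mul_pow_le_of_hasChain hβ hW0.le hB₀ j hW K A h0 hA
  | succ i ih =>
    intro j hj K A h0 hA
    have hB₀1 : 1 ≤ B₀ := by
      have h := hB₀ 0
      rw [Finset.sum_range_one, pow_zero, mul_one, nbwLoopsAll_zero] at h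
      exact h
    have hB₀0 : 0 ≤ B₀ := by linarith
    have hWi : 0 ≤ W⁻¹ := inv_nonneg.2 hW0.le
    have hCi : 0 ≤ chainStartConst B₀ W i := chainStartConst_nonneg hB₀0 hW0.le i
    -- the loop series at this pivot is at most `B₀`
    have hloop : ∀ s : Dir d, ∑ j ∈ range K, ((closedNbwPen A s j).card : ℝ) * β ^ j ≤ B₀ := by
      intro s
      calc ∑ j ∈ range K, ((closedNbwPen A s j).card : ℝ) * β ^ j
          ≤ ∑ j ∈ range (K + 1), ((closedNbwPen A s j).card : ℝ) * β ^ j :=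
            Finset.sum_le_sum_of_subset_of_nonneg (Finset.range_mono (Nat.le_succ K))
              fun j _ _ => mul_nonneg (Nat.cast_nonneg _) (pow_nonneg hβ _)
        _ ≤ ∑ j ∈ range (K + 1), (nbwLoopsAll d j : ℝ) * β ^ j :=
            Finset.sum_le_sum fun j _ => mul_le_mul_of_nonneg_right
              (by exact_mod_cast card_closedNbwPen_le_nbwLoopsAll A s j) (pow_nonneg hβ _)
        _ ≤ B₀ := hB₀ K
    -- the tail series: one more chain site behind the next pivot
    have htail : ∀ s : Dir d, (0 : Site d) ∉ shiftSet A s →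
        ∑ j ∈ range K, ((nbwAvoid (shiftSet A s) j).card : ℝ) * β ^ j ≤
          chainStartConst B₀ W i * ∑ m ∈ range K, ((sawAvoid (shiftSet A s) m).card : ℝ) * β ^ m * W ^ m := by
      intro s hs
      cases K with
      | zero => simp
      | succ K' =>
        have hsA : stepVec s ∉ A := by
          intro hmem
          apply hs
          rw [mem_shiftSet, zero_add]
          exact Finset.mem_insert_of_mem hmem
        exact ih (j + 1) (by omega) K' (shiftSet A s) hs (hasChain_shiftSet hA hsA)
    have hterm : ∀ s : Dir d,
        (∑ j ∈ range K, ((closedNbwPen A s j).card : ℝ) * β ^ j) *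
            ∑ j ∈ range K, ((nbwAvoid (shiftSet A s) j).card : ℝ) * β ^ j ≤
          B₀ * (chainStartConst B₀ W i *
            ∑ m ∈ range K, ((sawAvoid (shiftSet A s) m).card : ℝ) * β ^ m * W ^ m) := by
      intro s
      have hR0 : 0 ≤ B₀ * (chainStartConst B₀ W i * ∑ m ∈ range K,
          ((sawAvoid (shiftSet A s) m).card : ℝ) * β ^ m * W ^ m) :=
        mul_nonneg hB₀0 (mul_nonneg hCi (Finset.sum_nonneg fun m _ =>
          mul_nonneg (mul_nonneg (Nat.cast_nonneg _) (pow_nonneg hβ _)) (pow_nonneg hW0.le _)))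
      by_cases h0s : (0 : Site d) ∈ shiftSet A s
      · have hz : ∑ j ∈ range K, ((nbwAvoid (shiftSet A s) j).card : ℝ) * β ^ j = 0 := by
          refine Finset.sum_eq_zero fun j _ => ?_
          rw [nbwAvoid_eq_empty_of_mem h0s, Finset.card_empty, Nat.cast_zero, zero_mul]
        rw [hz, mul_zero]
        exact hR0
      · exact mul_le_mul (hloop s) (htail s h0s)
          (Finset.sum_nonneg fun j _ => mul_nonneg (Nat.cast_nonneg _) (pow_nonneg hβ _)) hB₀0
    have hsum : ∑ s : Dir d, (∑ j ∈ range K, ((closedNbwPen A s j).card : ℝ) * β ^ j) *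
          ∑ j ∈ range K, ((nbwAvoid (shiftSet A s) j).card : ℝ) * β ^ j ≤
        B₀ * (chainStartConst B₀ W i * ∑ m ∈ range K, ((sawAvoid A (m + 1)).card : ℝ) * β ^ m * W ^ m) := by
      refine (Finset.sum_le_sum fun s _ => hterm s).trans ?_
      rw [← Finset.mul_sum, ← Finset.mul_sum]
      refine mul_le_mul_of_nonneg_left (mul_le_mul_of_nonneg_left ?_ hCi) hB₀0
      rw [Finset.sum_comm]
      refine Finset.sum_le_sum fun m _ => ?_
      rw [← Finset.sum_mul, ← Finset.sum_mul]
      refine mul_le_mul_of_nonneg_right (mul_le_mul_of_nonneg_right ?_ (pow_nonneg hβ _)) (pow_nonneg hW0.le _)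
      exact_mod_cast sum_card_sawAvoid_shift_le h0 m
    -- the comparison sum `S = Σ_{m≤K} #sawAvoid A m β^m W^m ≥ 1`
    set S : ℝ := ∑ m ∈ range (K + 1), ((sawAvoid A m).card : ℝ) * β ^ m * W ^ m with hSdef
    have hS : S = 1 + W * (β * ∑ m ∈ range K, ((sawAvoid A (m + 1)).card : ℝ) * β ^ m * W ^ m) := by
      rw [hSdef, Finset.sum_range_succ' _ K, card_sawAvoid_zero h0, Nat.cast_one, pow_zero, pow_zero, mul_one,
        mul_one, add_comm, Finset.mul_sum, Finset.mul_sum]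
      congr 1
      refine Finset.sum_congr rfl fun m _ => ?_
      rw [pow_succ, pow_succ]
      ring
    have hT0 : 0 ≤ β * ∑ m ∈ range K, ((sawAvoid A (m + 1)).card : ℝ) * β ^ m * W ^ m :=
      mul_nonneg hβ (Finset.sum_nonneg fun m _ =>
        mul_nonneg (mul_nonneg (Nat.cast_nonneg _) (pow_nonneg hβ _)) (pow_nonneg hW0.le _))
    have hS1 : 1 ≤ S := by
      rw [hS]
      nlinarith [mul_nonneg hW0.le hT0]
    have hTS : β * ∑ m ∈ range K, ((sawAvoid A (m + 1)).card : ℝ) * β ^ m * W ^ m ≤ W⁻¹ * S := by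
      have e : β * ∑ m ∈ range K, ((sawAvoid A (m + 1)).card : ℝ) * β ^ m * W ^ m = W⁻¹ * (S - 1) := by
        rw [hS, add_sub_cancel_left, ← mul_assoc, inv_mul_cancel₀ hW0.ne', one_mul]
      rw [e]
      exact mul_le_mul_of_nonneg_left (by linarith) hWi
    calc ∑ n ∈ range (K + 1), ((nbwAvoid A n).card : ℝ) * β ^ n
        ≤ ∑ n ∈ range (K + 1), (nbwLoopsAll d n : ℝ) * β ^ n +
            β * ∑ s : Dir d, (∑ j ∈ range K, ((closedNbwPen A s j).card : ℝ) * β ^ j) *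
              ∑ j ∈ range K, ((nbwAvoid (shiftSet A s) j).card : ℝ) * β ^ j :=
          sum_card_nbwAvoid_mul_pow_le_step hβ A K
      _ ≤ B₀ + β * (B₀ * (chainStartConst B₀ W i *
            ∑ m ∈ range K, ((sawAvoid A (m + 1)).card : ℝ) * β ^ m * W ^ m)) :=
          add_le_add (hB₀ K) (mul_le_mul_of_nonneg_left hsum hβ)
      _ = B₀ + B₀ * chainStartConst B₀ W i *
            (β * ∑ m ∈ range K, ((sawAvoid A (m + 1)).card : ℝ) * β ^ m * W ^ m) := by ring
      _ ≤ B₀ * S + B₀ * chainStartConst B₀ W i * (W⁻¹ * S) :=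
          add_le_add (le_mul_of_one_le_right hB₀0 hS1) (mul_le_mul_of_nonneg_left hTS (mul_nonneg hB₀0 hCi))
      _ = chainStartConst B₀ W (i + 1) * S := by
          rw [chainStartConst_succ]
          ring

/-- **The whole word, at series level**: with a `k`-chain taboo from the `(k+1)`-st pivot on and free loops before,
`Σ_{n≤K} b_n βⁿ ≤ chainStartConst B₀ W k · Σ_{m≤K} c_m β^m W^m`.
[cite: HaraSladeSokal1993, §2.4 eq. (2.37)–(2.38) p. 10 (summed over x; τ = 2, general k)] -/
theorem sum_card_nbwWords_mul_pow_le_chain {β W B₀ : ℝ} (hβ : 0 ≤ β) (hW0 : 0 < W)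
    (hB₀ : ∀ K : ℕ, ∑ j ∈ range (K + 1), (nbwLoopsAll d j : ℝ) * β ^ j ≤ B₀) (k : ℕ)
    (hW : ∀ (τ : StepSeq d k) (s : Dir d), Set.InjOn (pos τ) (Set.Icc 0 k) → stepVec s ∉ chainSet τ →
      ∀ K : ℕ, ∑ j ∈ range (K + 1), ((closedNbwPen (chainSet τ) s j).card : ℝ) * β ^ j ≤ W) (K : ℕ) :
    ∑ n ∈ range (K + 1), ((nbwWords d n).card : ℝ) * β ^ n ≤
      chainStartConst B₀ W k * ∑ m ∈ range (K + 1), (count d m : ℝ) * β ^ m * W ^ m := by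
  have h := sum_card_nbwAvoid_mul_pow_le_startup hβ hW0 hB₀ k hW k 0 (zero_add k) K (∅ : Finset (Site d))
    (Finset.notMem_empty _) (hasChain_zero _)
  calc ∑ n ∈ range (K + 1), ((nbwWords d n).card : ℝ) * β ^ n
      = ∑ n ∈ range (K + 1), ((nbwAvoid (∅ : Finset (Site d)) n).card : ℝ) * β ^ n := by
        refine Finset.sum_congr rfl fun n _ => ?_
        rw [card_nbwAvoid_empty]
    _ ≤ chainStartConst B₀ W k *
          ∑ m ∈ range (K + 1), ((sawAvoid (∅ : Finset (Site d)) m).card : ℝ) * β ^ m * W ^ m := h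
    _ = chainStartConst B₀ W k * ∑ m ∈ range (K + 1), (count d m : ℝ) * β ^ m * W ^ m := by
        congr 1
        refine Finset.sum_congr rfl fun m _ => ?_
        rw [card_sawAvoid_empty]

/-! ### The bound on `μ(ℤ^d)` at `β = 1/(2d−1)` -/

/-- **Hara–Slade–Sokal (2.36)+(2.39) with `τ = 2` and a `k`-site taboo chain, the maximum over the geometry taken at
the level of the series: `μ(ℤ^d) ≥ (2d − 1)/W`** for every `d ≥ 3`, every `k ≥ 0` and every `W > 0` bounding, for EACH
`k`-step word `τ` with distinct positions at the times `0, …, k` and EACH direction `s` with `e_s ∉ chainSet τ`, the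
partial sums `Σ_{j≤K} #closedNbwPen (chainSet τ) s j (2d−1)^{−j}` of the generating function
`C̃^{A;e}₂(0,0;1/(2d−1))`, `A = chainSet τ = {τ(1), …, τ(k)}`, `e = e_s`, of the closed NBW loops at `0` avoiding `A`
whose next-to-last site is not `e`.  AS PRINTED: "`Π̃_τ(k;β) = max_{A,e} C̃^{A;e}_τ(0,0;β)` (2.36) where the maximum
ranges over all `k`-element sets `A` which are the range of a `(k−1)`-step self-avoiding walk starting at a nearest
neighbour of the origin, and over all nearest neighbours `e` of the origin satisfying `e ∉ A` … Arguing as before, we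
have `μ ≥ μ_τ/Π̃_τ(k; μ_τ^{−1})` for `τ = 2, k ≥ 0` (2.39)", `μ₂ = 2d − 1`.
[cite: HaraSladeSokal1993, §2.4 eq. (2.36) p. 10 and eq. (2.39) p. 11 (τ = 2, every k ≥ 0), with (2.14) p. 6 for the free loops] -/
theorem hss_memoryTwo_chain_div_le_connectiveConstant (hd : 3 ≤ d) (k : ℕ) {W : ℝ} (hW0 : 0 < W)
    (hW : ∀ (τ : StepSeq d k) (s : Dir d), Set.InjOn (pos τ) (Set.Icc 0 k) → stepVec s ∉ chainSet τ →
      ∀ K : ℕ, ∑ j ∈ range (K + 1), ((closedNbwPen (chainSet τ) s j).card : ℝ) * (1 / (2 * (d : ℝ) - 1)) ^ j ≤ W) :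
    (2 * (d : ℝ) - 1) / W ≤ connectiveConstant d := by
  set β : ℝ := 1 / (2 * (d : ℝ) - 1) with hβdef
  set B₀ : ℝ := (2 * (d : ℝ) - 2) / (2 * (d : ℝ) - 1) * srwI d 1 0 0 with hB₀def
  have hd3 : (3 : ℝ) ≤ d := by exact_mod_cast hd
  have hpos : (0 : ℝ) < 2 * (d : ℝ) - 1 := by linarith
  have hβ0 : 0 < β := one_div_pos.2 hpos
  have hB₀ : ∀ K, ∑ j ∈ range (K + 1), (nbwLoopsAll d j : ℝ) * β ^ j ≤ B₀ := fun K =>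
    sum_nbwLoopsAll_mul_pow_le hd K
  have hB₀1 : 1 ≤ B₀ := by
    have h := hB₀ 0
    rw [Finset.sum_range_one, pow_zero, mul_one, nbwLoopsAll_zero] at h
    exact h
  have hB₀0 : 0 ≤ B₀ := by linarith
  set C : ℝ := chainStartConst B₀ W k with hCdef
  have hC : 0 ≤ C := chainStartConst_nonneg hB₀0 hW0.le k
  have key : 1 / (β * W) ≤ connectiveConstant d := by
    refine div_le_connectiveConstant_of (by omega) hβ0 hC hW0 fun N => ?_
    have hN : (N : ℝ) + 1 ≤ ∑ n ∈ range (N + 1), ((nbwWords d n).card : ℝ) * β ^ n := by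
      have h1 : (N : ℝ) + 1 = ∑ _n ∈ range (N + 1), (1 : ℝ) := by simp
      rw [h1]
      exact Finset.sum_le_sum fun n _ => one_le_card_nbwWords_mul_pow (by omega) n
    refine hN.trans ((sum_card_nbwWords_mul_pow_le_chain hβ0.le hW0 hB₀ k hW N).trans (le_of_eq ?_))
    rw [Finset.mul_sum]
    refine Finset.sum_congr rfl fun m _ => ?_
    ring
  have e : 1 / (β * W) = (2 * (d : ℝ) - 1) / W := by
    rw [hβdef]
    field_simp
  rw [← e]
  exact key

/-! ### The case `k = 2`: the taboo sets `{e_t, e_t + e_{t'}}` -/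

/-- The taboo chain of a two-step word `t t'` is `{e_t, e_t + e_{t'}}`.
[cite: HaraSladeSokal1993, §2.4 eq. (2.36) p. 10 and Table 2 p. 12 (row (2̃,2): two-element sets A)] -/
theorem chainSet_two (τ : StepSeq d 2) : chainSet τ = {stepVec (τ 0), stepVec (τ 0) + stepVec (τ 1)} := by
  have h1 : pos τ 1 = stepVec (τ 0) := by
    rw [pos_succ τ (show 0 < 2 by norm_num), pos_zero, zero_add]
    rfl
  have h2 : pos τ 2 = stepVec (τ 0) + stepVec (τ 1) := by
    rw [pos_succ τ (show 1 < 2 by norm_num), h1]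
    rfl
  unfold chainSet
  rw [Finset.range_add_one, Finset.image_insert, Finset.range_one, Finset.image_singleton, zero_add, h1, h2,
    Finset.pair_comm]

/-- **Row `(2̃,2)` before evaluation: `μ(ℤ^d) ≥ (2d − 1)/W`** (`d ≥ 3`, `W > 0`) as soon as `W` bounds the partial sums
`Σ_{j≤K} #closedNbwPen {e_t, e_t + e_{t'}} s j (2d−1)^{−j}` for all directions `t, t', s` with `t' ≠ −t` (the
two-element set `A = {e_t, e_t + e_{t'}}` is the range of a one-step SAW from the neighbour `e_t` of `0`) and `s ≠ t`
(`e_s ∉ A`; `e_s = e_t + e_{t'}` is impossible).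
[cite: HaraSladeSokal1993, §2.4 eq. (2.36)+(2.39) p. 10–11 and Table 2 p. 12 (row (2̃,2), τ = 2, k = 2)] -/
theorem hss_memoryTwo_twoChain_div_le_connectiveConstant (hd : 3 ≤ d) {W : ℝ} (hW0 : 0 < W)
    (hW : ∀ t t' s : Dir d, t' ≠ t.neg → s ≠ t → ∀ K : ℕ,
      ∑ j ∈ range (K + 1), ((closedNbwPen {stepVec t, stepVec t + stepVec t'} s j).card : ℝ) *
        (1 / (2 * (d : ℝ) - 1)) ^ j ≤ W) :
    (2 * (d : ℝ) - 1) / W ≤ connectiveConstant d := by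
  refine hss_memoryTwo_chain_div_le_connectiveConstant hd 2 hW0 fun τ s hinj hs K => ?_
  rw [chainSet_two] at hs ⊢
  refine hW (τ 0) (τ 1) s ?_ ?_ K
  · intro h
    have h2 : pos τ 2 = pos τ 0 := by
      have e2 : pos τ 2 = stepVec (τ 0) + stepVec (τ 1) := by
        rw [pos_succ τ (show 1 < 2 by norm_num), pos_succ τ (show 0 < 2 by norm_num), pos_zero, zero_add]
        rfl
      rw [e2, h, stepVec_neg, add_neg_cancel, pos_zero]
    have h20 : (2 : ℕ) = 0 :=
      hinj (Set.mem_Icc.2 ⟨Nat.zero_le _, le_rfl⟩) (Set.mem_Icc.2 ⟨le_rfl, Nat.zero_le _⟩) h2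
    omega
  · intro h
    apply hs
    rw [h]
    exact Finset.mem_insert_self _ _

end Literature.Probability.RandomPlanarGeometry.SAW.Zd.LoopErasure

end
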